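import Summits.ResolutionOfSingularities.ResolutionOfSingularities.Theorems.PurelyInseparableDim4ResConeTwoSlotGameStepSigma
import HarnessLib
import HarnessLib.Audit.Tags

/-!
# Purely inseparable four-folds — the two-slot σ-game: the step laws DRESSED as the `P`-binders of `CInfGame.Exact.no_infinite_play`
# (K24a-PRIME-σ assembly δ, game side; cell `res-dim4-pi`, K2(p) lane B-LF (iii-b); holder rulings g5-17/g5-18)

[OURS · counted 0 · cell `res-dim4-pi` · K2(p) lane holder res-dim4-p-12 g5; the δ assembly is res-dim4-p-7 g6's (`…TwoSlotTailSigma`, bus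
2026-08-29 12:41Z), who adopted res-dim4-p-9 g5's binder map (12:39Z) and asked for these dressing one-liners (12:44Z); seat res-dim4-p-9 g5
(author lineage of `CInfGame.Exact`, p-9 g3) over res-dim4-p-1 g6's step layer `…TwoSlotGameStepSigma` (p719168).]  Nothing here proves any
TAIL(p, d, 3), K2(7), K2(p) or resolution of singularities in dimension ≥ 4 / characteristic `p` — NOT proved.  AI kernel work, weaker
than expert review.

With the σ-game exponent `E(c,a,b,e) := (a+n+1)·j + (b+n+1)·i + (e+w)·u + (d−1−c)·f` (slots `j, i` of weight `n`, passive `u` of weight `w`,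
carrier `f`, `n + w + d = p`) and the PRESENCE predicate `P s (c,a,b,e) := c + 1 ≤ d ∧ coeff E(c,a,b,e) s.F ≠ 0`, the assembly instantiates
`CInfGame.Exact.no_infinite_play` with `P t := P (c′ (k₀ + t))` and `x t := [chart at k₀ + t is j]`.  This file supplies the per-step binders
`hfwdL/hfwdM/hevol` at STATE level for a pure corner step in either slot:
* `gameExp_slot_comm` — `E` written from the `i`-slot is the same exponent (commuting the two slot summands);
* **`game_fwd_slot_j` / `game_fwd_slot_i`** (`hfwdL` / `hfwdM`): a present monomial of a STRAIGHT parent of order `≥ p + n` with LIVE image is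
  present at the child `step p univ j 0 s` / `step p univ i 0 s` (p-1's `coeff_step_zero_gameExp_ne_zero_sigma`);
* **`game_evol_slot_j` / `game_evol_slot_i`** (`hevol`, one chart each): a monomial present at the child is DEAD or the image of a present
  parent monomial with the same `(c, ·, e)` (p-1's `exists_parent_of_coeff_step_zero_gameExp_of_ledger_sigma`, ledger exception excluded by
  the slot ledger `hled`).
`hlegL/M` and `hflagL/M` are res-dim4-p-7 g6's `twoSlot_legal(M)_gameExp_sigma` / `twoSlot_flagL/M_gameExp_sigma` (p719195/p719218) verbatim;
`hC` is `c + 1 ≤ d`.  NOT here: the tail normal form (pure corners in one straight frame — typ-1's transport) and the assembly itself (p-7 g6).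
[cite: CossartJannsenSaito2020, Lemma 13.2, Thm. 3.14] [cite: Hauser2010, §§F–G]
bears_on: LADDER-RESOLUTION:D157-DOOR2 (res-dim4-pi · K2(p) B-LF (iii-b) · σ-game P-dressing).  Supports stmt-ResolutionOfSingularities-16155
(helper).
-/

set_option linter.dupNamespace false -- mandated namespace of this single-conjunct summit

noncomputable section

namespace Summit.ResolutionOfSingularities.ResolutionOfSingularities.Theorems.PIDim4

namespace ResCone

open MvPolynomial Finset
open Literature.AlgebraicGeometry.Resolution
open Literature.AlgebraicGeometry.Resolution.CentreBlowup
open Literature.AlgebraicGeometry.Resolution.Hauser2010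
open Literature.AlgebraicGeometry.Resolution.HauserPerlega2019

variable {K : Type} [Field K]

section Dressing

variable [DecidableEq K]
variable {j i u f : Fin 4} (hji : j ≠ i) (hju : j ≠ u) (hjf : j ≠ f) (hiu : i ≠ u) (hif : i ≠ f) (huf : u ≠ f)
include hji hju hjf hiu hif huf

omit [DecidableEq K] hji hju hjf hiu hif huf in
/-- The σ-game exponent read from the `i`-slot is the same exponent (the two slot summands commute). [folklore] -/
theorem gameExp_slot_comm (n w d c a b e : ℕ) :
    (Finsupp.single i (b + n + 1) + Finsupp.single j (a + n + 1) + Finsupp.single u (e + w) + Finsupp.single f (d - 1 - c) :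
      Fin 4 →₀ ℕ) =
      Finsupp.single j (a + n + 1) + Finsupp.single i (b + n + 1) + Finsupp.single u (e + w) + Finsupp.single f (d - 1 - c) := by
  rw [add_comm (Finsupp.single i (b + n + 1)) (Finsupp.single j (a + n + 1))]

/-- **`hfwdL` — FORWARD in the `j`-slot, P-form.**  At a state of order `≥ p + n` which is STRAIGHT (`|e| = p + n ⇒ e f = d`), a present
σ-game monomial (`c + 1 ≤ d ∧ coeff E(c,a,b,e) ≠ 0`) with LIVE `j`-image has its image present at the pure-corner child in the chart of `j`.
[OURS] [cite: Hauser2010, §§F–G] -/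
theorem game_fwd_slot_j (p : ℕ) {n w d : ℕ} (hσ : n + w + d = p) (s : State K)
    (hq : ((p : ℕ) : ℕ∞) ≤ ordAlong Finset.univ s.F) (h6 : ∀ e ∈ s.F.support, p + n ≤ e.degree)
    (hstraight : ∀ e ∈ s.F.support, e.degree = p + n → e f = d) {c a b e : ℕ}
    (hP : c + 1 ≤ d ∧ coeff (Finsupp.single j (a + n + 1) + Finsupp.single i (b + n + 1) + Finsupp.single u (e + w) +
      Finsupp.single f (d - 1 - c)) s.F ≠ 0)
    (hlive : ¬ (c ≤ (a + b + e - c) + e ∧ c ≤ b + e)) :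
    c + 1 ≤ d ∧ coeff (Finsupp.single j (a + b + e - c + n + 1) + Finsupp.single i (b + n + 1) + Finsupp.single u (e + w) +
      Finsupp.single f (d - 1 - c)) (CentreBlowup.step p Finset.univ j 0 s).F ≠ 0 :=
  ⟨hP.1, coeff_step_zero_gameExp_ne_zero_sigma hji hju hjf hiu hif huf p hσ s hq h6 hstraight hP.1 hP.2 hlive⟩

/-- **`hfwdM` — FORWARD in the `i`-slot, P-form** (the `j`-law with the slots exchanged). [OURS] [cite: Hauser2010, §§F–G] -/
theorem game_fwd_slot_i (p : ℕ) {n w d : ℕ} (hσ : n + w + d = p) (s : State K)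
    (hq : ((p : ℕ) : ℕ∞) ≤ ordAlong Finset.univ s.F) (h6 : ∀ e ∈ s.F.support, p + n ≤ e.degree)
    (hstraight : ∀ e ∈ s.F.support, e.degree = p + n → e f = d) {c a b e : ℕ}
    (hP : c + 1 ≤ d ∧ coeff (Finsupp.single j (a + n + 1) + Finsupp.single i (b + n + 1) + Finsupp.single u (e + w) +
      Finsupp.single f (d - 1 - c)) s.F ≠ 0)
    (hlive : ¬ (c ≤ a + e ∧ c ≤ (a + b + e - c) + e)) :
    c + 1 ≤ d ∧ coeff (Finsupp.single j (a + n + 1) + Finsupp.single i (a + b + e - c + n + 1) + Finsupp.single u (e + w) +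
      Finsupp.single f (d - 1 - c)) (CentreBlowup.step p Finset.univ i 0 s).F ≠ 0 := by
  refine ⟨hP.1, ?_⟩
  have h := coeff_step_zero_gameExp_ne_zero_sigma hji.symm hiu hif hju hjf huf p hσ s hq h6 hstraight hP.1 (a := b) (b := a) (e := e)
    (by rw [gameExp_slot_comm]; exact hP.2) (by rw [show b + a + e - c = a + b + e - c by rw [Nat.add_comm b a]]; tauto)
  rwa [show b + a + e - c = a + b + e - c by rw [Nat.add_comm b a], gameExp_slot_comm] at h

/-- **`hevol` in the `j`-slot, P-form.**  A σ-game monomial `E(c, a′, b, e)` present at the pure-corner child in the chart of `j` of a state with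
`x_j^n ∣ F` (`n ≤ e j` on the support) and the slot LEDGER (`e f ≤ d − 1 ⇒ n + 1 ≤ e j`) is DEAD or the image of a present parent monomial
`E(c, a₀, b, e)` with `a′ = a₀ + b + e − c`. [OURS] [cite: CossartJannsenSaito2020, Lemma 13.2] -/
theorem game_evol_slot_j (p : ℕ) {n w d : ℕ} (hσ : n + w + d = p) (s : State K)
    (hrn : ∀ e ∈ s.F.support, n ≤ e j) (hled : ∀ e ∈ s.F.support, e f ≤ d - 1 → n + 1 ≤ e j) {c a' b e : ℕ}
    (hP' : c + 1 ≤ d ∧ coeff (Finsupp.single j (a' + n + 1) + Finsupp.single i (b + n + 1) + Finsupp.single u (e + w) +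
      Finsupp.single f (d - 1 - c)) (CentreBlowup.step p Finset.univ j 0 s).F ≠ 0) :
    (c ≤ a' + e ∧ c ≤ b + e) ∨
      ∃ a₀ b₀, (c + 1 ≤ d ∧ coeff (Finsupp.single j (a₀ + n + 1) + Finsupp.single i (b₀ + n + 1) + Finsupp.single u (e + w) +
        Finsupp.single f (d - 1 - c)) s.F ≠ 0) ∧ a' = a₀ + b₀ + e - c ∧ b = b₀ := by
  obtain ⟨a₀, ha₀, hrel⟩ :=
    exists_parent_of_coeff_step_zero_gameExp_of_ledger_sigma hji hju hjf hiu hif huf p hσ s hrn hled hP'.1 hP'.2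
  exact Or.inr ⟨a₀, b, ⟨hP'.1, ha₀⟩, by omega, rfl⟩

/-- **`hevol` in the `i`-slot, P-form** (the `j`-law with the slots exchanged): present at the child in the chart of `i` ⇒ dead or the image of
a present parent monomial `E(c, a, b₀, e)` with `b′ = a + b₀ + e − c`. [OURS] [cite: CossartJannsenSaito2020, Lemma 13.2] -/
theorem game_evol_slot_i (p : ℕ) {n w d : ℕ} (hσ : n + w + d = p) (s : State K)
    (hrn : ∀ e ∈ s.F.support, n ≤ e i) (hled : ∀ e ∈ s.F.support, e f ≤ d - 1 → n + 1 ≤ e i) {c a b' e : ℕ}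
    (hP' : c + 1 ≤ d ∧ coeff (Finsupp.single j (a + n + 1) + Finsupp.single i (b' + n + 1) + Finsupp.single u (e + w) +
      Finsupp.single f (d - 1 - c)) (CentreBlowup.step p Finset.univ i 0 s).F ≠ 0) :
    (c ≤ a + e ∧ c ≤ b' + e) ∨
      ∃ a₀ b₀, (c + 1 ≤ d ∧ coeff (Finsupp.single j (a₀ + n + 1) + Finsupp.single i (b₀ + n + 1) + Finsupp.single u (e + w) +
        Finsupp.single f (d - 1 - c)) s.F ≠ 0) ∧ a = a₀ ∧ b' = a₀ + b₀ + e - c := by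
  have h := hP'.2
  rw [← gameExp_slot_comm] at h
  obtain ⟨b₀, hb₀, hrel⟩ :=
    exists_parent_of_coeff_step_zero_gameExp_of_ledger_sigma hji.symm hiu hif hju hjf huf p hσ s hrn hled hP'.1 (a' := b') (b := a)
      (e := e) h
  refine Or.inr ⟨a, b₀, ⟨hP'.1, ?_⟩, rfl, by omega⟩
  rwa [gameExp_slot_comm] at hb₀

end Dressing

end ResCone

end Summit.ResolutionOfSingularities.ResolutionOfSingularities.Theorems.PIDim4

end
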